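import Mathlib
import Literature.Computability.AlgebraicComplexity.SecondFundamentalTheoremGL
import Summits.MatrixMultiplication.MatrixMultiplication.Theorems.SubgroupIdentityDesigns.Negative.PackingBridge
import Summits.MatrixMultiplication.MatrixMultiplication.Theorems.SubgroupIdentityDesigns.Negative.FlagTwistFamily

/-!
# The witness window: pricing floor versus wall ceiling for every witness of the crux, and the
# uniform-in-`m` level-one squeeze
(negative-side lemmas for the crux `SubgroupIdentityDesigns`, stmt-MatrixMultiplication-14079; cell
B2b-5 `b2b-lgcu-borel`, gen 11 — report `run/shared/lean/b2b/levelgraded-cu/ORACLE-g11.md` §G11-3.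
VALUE = theorem, NOT summit progress.)

Every witness `(p, m = k+l, k, H₁, H₂, H₃)` of the crux at exponent `ε` is squeezed between two tree
theorems:
* FLOOR (pricing, `FlagTwistFamily.budget_ge_family`): `C(p−2,k) · (p^{kl} p^{k(k−1)/2})^{2+ε} ≤ budget
  < V^{(2+ε)/3}`;
* CEILING (walls, `PackingBridge.crux_walls` + `LevelSpace.finrank_levelSubmodule_le`):
  `2 V² ≤ (dim F_k|_G)³ ≤ N_k³`, `N_k = #{M ∈ M_m(𝔽_p) : rk M ≤ k}`.
`window` records both.  At level `k = 1` the two meet up to a constant: with the count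
`N_1 · (p−1) ≤ p^{2m}` (`card_rankLE_one_mul_le`, from `M = u wᵀ` and
`#ℙ^{m−1}(𝔽_p) · (p−1) = p^m − 1`) every level-one witness in `GL_{1+l}(𝔽_p)` — ANY `l`, i.e. uniformly
in the matrix size — forces the `m`-FREE inequality
  `(p−2)² · 2^{(2+ε)/3} · (p−1)^{2+ε} < (p²)^{2+ε}`            (`levelOne_squeeze`),
which FAILS at `ε = 0` for every prime `p ≥ 17` (`2^{1/3}(p−2)(p−1) ≥ p²`); hence
`no_levelOne_witness_of_le`: whenever `(p²)^{2+ε} ≤ (p−2)² 2^{(2+ε)/3} (p−1)^{2+ε}` (e.g. `p ≥ 17` and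
`ε ≤ ε₁(p)`, `ε₁(17) ≈ 0.034`, `ε₁(101) ≈ 0.091`, `ε₁(1009) ≈ 0.068`, `ε₁(p) ~ (2 ln 2)/(3 ln p)`), NO
subgroup triple of ANY `GL_m(𝔽_p)` is a level-one witness of the crux at `ε`.  (Fixed-host no-go's —
`PackingBridge.crux_no_fixed_host` — need `|GL_m(𝔽_p)|` bounded; this one is uniform in `m`.)
-/

set_option linter.dupNamespace false

noncomputable section

open scoped BigOperators Classical Matrix
open Literature.Barriers.MatrixMultiplication (SubgroupTPP)
open Module (finrank)

namespace Summit.MatrixMultiplication.MatrixMultiplication.Theorems.SubgroupIdentityDesigns.Negative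
namespace WitnessWindow

open Summit.MatrixMultiplication.MatrixMultiplication.Theorems.LieRankDesigns.Negative
  (GLm Mat budget)
open Summit.MatrixMultiplication.MatrixMultiplication.Theorems.LevelOneGL2Designs.Negative
  (levelSubmodule finrank_levelSubmodule_le)
open Literature.Computability.AlgebraicComplexity (exists_eq_mul_of_rank_le)
open PackingBridge (crux_walls)
open FlagTwistFamily (budget_ge_family)

variable {p : ℕ} [hp : Fact p.Prime]

/-! ## The two-sided window for every witness -/

/-- **THE WITNESS WINDOW.**  A witness of the crux at `ε` in `GL_{k+l}(𝔽_p)` at level `k` has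
`C(p−2,k) (p^{kl} p^{∑_{i<k} i})^{2+ε} < V^{(2+ε)/3}` (pricing floor) and `2V² ≤ N_k³` (wall ceiling). -/
theorem window {k l : ℕ} {ε : ℝ} (hε : 0 < ε) {H₁ H₂ H₃ : Subgroup (GLm p (k + l))}
    (htpp : SubgroupTPP H₁ H₂ H₃)
    (hdes : ∃ c : Mat p (k + l) → ℂ, (∀ M, k < M.rank → c M = 0) ∧
      (∑ M, c M * ZMod.stdAddChar (Matrix.trace (M * ((1 : GLm p (k + l)) : Mat p (k + l))))) = 1 ∧
      ∀ a ∈ H₁, ∀ b ∈ H₂, ∀ g ∈ H₃, a * b * g ≠ 1 →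
        (∑ M, c M * ZMod.stdAddChar
          (Matrix.trace (M * ((a * b * g : GLm p (k + l)) : Mat p (k + l))))) = 0)
    (hlt : budget p (k + l) k (2 + ε) <
      ((Nat.card H₁ * Nat.card H₂ * Nat.card H₃ : ℕ) : ℝ) ^ ((2 + ε) / 3)) :
    ((Nat.choose (p - 2) k : ℕ) : ℝ) *
        (((p ^ (k * l) * p ^ (∑ i ∈ Finset.range k, i) : ℕ) : ℝ)) ^ (2 + ε) <
        ((Nat.card H₁ * Nat.card H₂ * Nat.card H₃ : ℕ) : ℝ) ^ ((2 + ε) / 3) ∧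
      2 * (Nat.card H₁ * Nat.card H₂ * Nat.card H₃) ^ 2 ≤
        (Fintype.card {M : Mat p (k + l) // M.rank ≤ k}) ^ 3 :=
  ⟨(budget_ge_family (p := p) (k := k) (l := l) (s := 2 + ε) (by linarith)).trans_lt hlt,
    (crux_walls hε htpp hdes hlt).trans
      (Nat.pow_le_pow_left (finrank_levelSubmodule_le (p := p) (m := k + l) (k := k)) 3)⟩

/-! ## Counting rank-`≤ 1` matrices: `N_1 · (p − 1) ≤ p^{2m}` -/

/-- Every matrix of rank `≤ 1` is `0` or `(rep L) · wᵀ` for a point `L` of `ℙ^{m−1}(𝔽_p)` and a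
vector `w`. [folklore] -/
theorem rankLE_one_surj (m : ℕ) :
    Function.Surjective (fun x : Unit ⊕ (Projectivization (ZMod p) (Fin m → ZMod p) × (Fin m → ZMod p)) =>
      (match x with
        | Sum.inl _ => (⟨0, by simp⟩ : {M : Mat p m // M.rank ≤ 1})
        | Sum.inr (L, w) => ⟨Matrix.vecMulVec L.rep w, Matrix.rank_vecMulVec_le _ _⟩)) := by
  rintro ⟨M, hM⟩
  obtain ⟨U, W, hUW⟩ := exists_eq_mul_of_rank_le M hM
  by_cases hu : (fun i => U i 0) = 0
  · refine ⟨Sum.inl (), ?_⟩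
    simp only
    congr 1
    rw [hUW]
    ext i j
    have hi : U i 0 = 0 := congr_fun hu i
    simp [Matrix.mul_apply, hi]
  · obtain ⟨a, ha⟩ := Projectivization.exists_smul_eq_mk_rep (ZMod p) (fun i => U i 0) hu
    refine ⟨Sum.inr (Projectivization.mk (ZMod p) (fun i => U i 0) hu,
      fun j => ((a⁻¹ : (ZMod p)ˣ) : ZMod p) * W 0 j), ?_⟩
    simp only
    congr 1
    rw [hUW, ← ha]
    ext i j
    have hav : ((a : (ZMod p)ˣ) : ZMod p) * ((a⁻¹ : (ZMod p)ˣ) : ZMod p) = 1 := Units.mul_inv a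
    simp only [Matrix.vecMulVec_apply, Pi.smul_apply, Matrix.mul_apply, Fin.sum_univ_one, Units.smul_def,
      smul_eq_mul]
    linear_combination (U i 0 * W 0 j) * hav

/-- **`N_1 · (p − 1) ≤ p^{2m}` for `m ≥ 1`**, `N_1 = #{M ∈ M_m(𝔽_p) : rk M ≤ 1}`
(`N_1 ≤ 1 + #ℙ^{m−1} · p^m` and `#ℙ^{m−1} · (p−1) = p^m − 1`). [folklore] -/
theorem card_rankLE_one_mul_le {m : ℕ} (hm : 1 ≤ m) :
    Fintype.card {M : Mat p m // M.rank ≤ 1} * (p - 1) ≤ p ^ (2 * m) := by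
  have hsurj := rankLE_one_surj (p := p) m
  have hle := Nat.card_le_card_of_surjective _ hsurj
  have hfun : Fintype.card (Fin m → ZMod p) = p ^ m := by simp [ZMod.card]
  simp only [Nat.card_sum, Nat.card_prod, Nat.card_eq_fintype_card (α := Unit), Fintype.card_unit,
    Nat.card_eq_fintype_card (α := {M : Mat p m // M.rank ≤ 1}),
    Nat.card_eq_fintype_card (α := Fin m → ZMod p), hfun] at hle
  have hP := Projectivization.card' (ZMod p) (Fin m → ZMod p)
  simp only [Nat.card_eq_fintype_card (α := Fin m → ZMod p), Nat.card_eq_fintype_card (α := ZMod p),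
    ZMod.card, hfun] at hP
  -- `N (p-1) ≤ (p-1) + #ℙ (p-1) p^m = (p-1) + (p^m - 1) p^m ≤ p^{2m}` using `p - 1 ≤ p^m`
  have h1 : Fintype.card {M : Mat p m // M.rank ≤ 1} * (p - 1) ≤
      (p - 1) + Nat.card (Projectivization (ZMod p) (Fin m → ZMod p)) * (p - 1) * p ^ m := by
    calc Fintype.card {M : Mat p m // M.rank ≤ 1} * (p - 1)
        ≤ (1 + Nat.card (Projectivization (ZMod p) (Fin m → ZMod p)) * p ^ m) * (p - 1) :=
          Nat.mul_le_mul_right _ hle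
      _ = (p - 1) + Nat.card (Projectivization (ZMod p) (Fin m → ZMod p)) * (p - 1) * p ^ m := by ring
  have h2 : Nat.card (Projectivization (ZMod p) (Fin m → ZMod p)) * (p - 1) = p ^ m - 1 := by omega
  rw [h2] at h1
  have hpm : p - 1 ≤ p ^ m := by
    calc p - 1 ≤ p := Nat.sub_le p 1
      _ = p ^ 1 := (pow_one p).symm
      _ ≤ p ^ m := Nat.pow_le_pow_right hp.out.pos hm
  have h3 : (p - 1) + (p ^ m - 1) * p ^ m ≤ p ^ (2 * m) := by
    have hpos : 1 ≤ p ^ m := Nat.one_le_pow _ _ hp.out.pos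
    zify [hpos, hp.out.one_lt.le] at hpm ⊢
    have : (p : ℤ) ^ (2 * m) = ((p : ℤ) ^ m) ^ 2 := by rw [pow_mul']
    nlinarith
  exact h1.trans h3

/-! ## The level-one squeeze, uniform in `m` -/

/-- **THE LEVEL-ONE SQUEEZE (uniform in `m`).**  A level-one witness of the crux at `ε` in
`GL_{1+l}(𝔽_p)` (any `l`) forces `(p−2)² · 2^{(2+ε)/3} · (p−1)^{2+ε} < (p²)^{2+ε}`. -/
theorem levelOne_squeeze {l : ℕ} {ε : ℝ} (hε : 0 < ε) {H₁ H₂ H₃ : Subgroup (GLm p (1 + l))}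
    (htpp : SubgroupTPP H₁ H₂ H₃)
    (hdes : ∃ c : Mat p (1 + l) → ℂ, (∀ M, 1 < M.rank → c M = 0) ∧
      (∑ M, c M * ZMod.stdAddChar (Matrix.trace (M * ((1 : GLm p (1 + l)) : Mat p (1 + l))))) = 1 ∧
      ∀ a ∈ H₁, ∀ b ∈ H₂, ∀ g ∈ H₃, a * b * g ≠ 1 →
        (∑ M, c M * ZMod.stdAddChar
          (Matrix.trace (M * ((a * b * g : GLm p (1 + l)) : Mat p (1 + l))))) = 0)
    (hlt : budget p (1 + l) 1 (2 + ε) <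
      ((Nat.card H₁ * Nat.card H₂ * Nat.card H₃ : ℕ) : ℝ) ^ ((2 + ε) / 3)) :
    ((p : ℝ) - 2) ^ 2 * (2 : ℝ) ^ ((2 + ε) / 3) * ((p : ℝ) - 1) ^ (2 + ε) <
      ((p : ℝ) ^ 2) ^ (2 + ε) := by
  obtain ⟨hfloor, hceil⟩ := window (k := 1) (l := l) hε htpp hdes hlt
  set s : ℝ := 2 + ε with hs_def
  have hs : 0 < s := by rw [hs_def]; linarith
  set V : ℕ := Nat.card H₁ * Nat.card H₂ * Nat.card H₃ with hV_def
  have hp2 : 2 ≤ p := hp.out.two_le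
  have hpR : (2 : ℝ) ≤ p := by exact_mod_cast hp2
  have hp1 : (0 : ℝ) < (p : ℝ) - 1 := by linarith
  -- floor, simplified at `k = 1`: `(p - 2) (p^l)^s < V^{s/3}`
  have hfl : ((p : ℝ) - 2) * ((p : ℝ) ^ l) ^ s < (V : ℝ) ^ (s / 3) := by
    have e1 : ((Nat.choose (p - 2) 1 : ℕ) : ℝ) = (p : ℝ) - 2 := by
      rw [Nat.choose_one_right, Nat.cast_sub hp2]; norm_num
    have e2 : (((p ^ (1 * l) * p ^ (∑ i ∈ Finset.range 1, i) : ℕ) : ℝ)) = (p : ℝ) ^ l := by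
      simp
    rw [e1, e2] at hfloor
    exact hfloor
  -- ceiling: `2 V² (p-1)^3 ≤ p^{6(1+l)}` in ℕ, then in ℝ
  have hN := card_rankLE_one_mul_le (p := p) (m := 1 + l) (by omega)
  have hce : 2 * V ^ 2 * (p - 1) ^ 3 ≤ p ^ (6 * (1 + l)) := by
    calc 2 * V ^ 2 * (p - 1) ^ 3 ≤ (Fintype.card {M : Mat p (1 + l) // M.rank ≤ 1}) ^ 3 * (p - 1) ^ 3 :=
          Nat.mul_le_mul_right _ hceil
      _ = (Fintype.card {M : Mat p (1 + l) // M.rank ≤ 1} * (p - 1)) ^ 3 := by ring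
      _ ≤ (p ^ (2 * (1 + l))) ^ 3 := Nat.pow_le_pow_left hN 3
      _ = p ^ (6 * (1 + l)) := by rw [← pow_mul]; ring_nf
  have hceR : 2 * (V : ℝ) ^ 2 * ((p : ℝ) - 1) ^ 3 ≤ (p : ℝ) ^ (6 * (1 + l)) := by
    have h1 : (1 : ℕ) ≤ p := hp.out.one_lt.le
    have h := (Nat.cast_le (α := ℝ)).mpr hce
    push_cast [Nat.cast_sub h1] at h
    exact h
  -- square the floor and raise the ceiling to the power `s/3`
  have hV0 : (0 : ℝ) ≤ (V : ℝ) := Nat.cast_nonneg _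
  have hA0 : 0 ≤ ((p : ℝ) - 2) * ((p : ℝ) ^ l) ^ s :=
    mul_nonneg (by linarith) (Real.rpow_nonneg (pow_nonneg (by linarith) _) _)
  have hsq : (((p : ℝ) - 2) * ((p : ℝ) ^ l) ^ s) ^ 2 < ((V : ℝ) ^ 2) ^ (s / 3) := by
    have h := pow_lt_pow_left₀ hfl hA0 two_ne_zero
    have e : ((V : ℝ) ^ (s / 3)) ^ 2 = ((V : ℝ) ^ 2) ^ (s / 3) := by
      rw [← Real.rpow_natCast ((V : ℝ) ^ (s / 3)) 2, ← Real.rpow_mul hV0,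
        ← Real.rpow_natCast (V : ℝ) 2, ← Real.rpow_mul hV0]
      congr 1
      push_cast
      ring
    rwa [e] at h
  have hVsq : (V : ℝ) ^ 2 ≤ (p : ℝ) ^ (6 * (1 + l)) / (2 * ((p : ℝ) - 1) ^ 3) := by
    rw [le_div_iff₀ (by positivity)]
    linarith
  have hup : ((V : ℝ) ^ 2) ^ (s / 3) ≤ ((p : ℝ) ^ (6 * (1 + l)) / (2 * ((p : ℝ) - 1) ^ 3)) ^ (s / 3) :=
    Real.rpow_le_rpow (by positivity) hVsq (by positivity)
  -- rewrite the right-hand side: `(p^{6m} / (2 (p-1)^3))^{s/3} = (p^l)^{2s} (p^2)^s / (2^{s/3} (p-1)^s)`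
  have hp0 : (0 : ℝ) ≤ (p : ℝ) := by linarith
  have hrhs : ((p : ℝ) ^ (6 * (1 + l)) / (2 * ((p : ℝ) - 1) ^ 3)) ^ (s / 3) =
      (((p : ℝ) ^ l) ^ s) ^ 2 * ((p : ℝ) ^ 2) ^ s / ((2 : ℝ) ^ (s / 3) * ((p : ℝ) - 1) ^ s) := by
    rw [Real.div_rpow (by positivity) (by positivity), Real.mul_rpow (by norm_num) (by positivity)]
    have e3 : ((p : ℝ) ^ (6 * (1 + l))) ^ (s / 3) = (((p : ℝ) ^ l) ^ s) ^ 2 * ((p : ℝ) ^ 2) ^ s := by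
      rw [show (p : ℝ) ^ (6 * (1 + l)) = (((p : ℝ) ^ l) ^ 2 * (p : ℝ) ^ 2) ^ 3 by ring,
        ← Real.rpow_natCast ((((p : ℝ) ^ l) ^ 2 * (p : ℝ) ^ 2)) 3, ← Real.rpow_mul (by positivity)]
      rw [show ((3 : ℕ) : ℝ) * (s / 3) = s by push_cast; ring, Real.mul_rpow (by positivity) (by positivity)]
      rw [show ((p : ℝ) ^ l) ^ 2 = ((p : ℝ) ^ l) ^ ((2 : ℕ) : ℝ) by rw [Real.rpow_natCast],
        ← Real.rpow_mul (by positivity), show ((2 : ℕ) : ℝ) * s = s * (2 : ℕ) by push_cast; ring,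
        Real.rpow_mul (by positivity), Real.rpow_natCast]
    have e4 : (((p : ℝ) - 1) ^ 3) ^ (s / 3) = ((p : ℝ) - 1) ^ s := by
      rw [← Real.rpow_natCast ((p : ℝ) - 1) 3, ← Real.rpow_mul hp1.le]
      congr 1; push_cast; ring
    rw [e3, e4]
  rw [hrhs] at hup
  have hlt2 := hsq.trans_le hup
  -- `((p-2) x^s)^2 < x^{2s} (p^2)^s / (2^{s/3} (p-1)^s)`  with `x^s > 0`  ⇒  the claim
  have hx : 0 < ((p : ℝ) ^ l) ^ s := Real.rpow_pos_of_pos (pow_pos (by linarith) _) _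
  have hden : 0 < (2 : ℝ) ^ (s / 3) * ((p : ℝ) - 1) ^ s := by positivity
  rw [lt_div_iff₀ hden] at hlt2
  have hx2 : 0 < (((p : ℝ) ^ l) ^ s) ^ 2 := by positivity
  nlinarith [hlt2, hx2]

/-- **NO LEVEL-ONE WITNESS IN ANY `GL_m(𝔽_p)` BELOW THE SQUEEZE THRESHOLD.**  If
`(p²)^{2+ε} ≤ (p−2)² 2^{(2+ε)/3} (p−1)^{2+ε}` (true for every prime `p ≥ 17` and all `ε ≤ ε₁(p)`,
`ε₁(p) > 0`), then no subgroup triple of `GL_{1+l}(𝔽_p)` — for ANY `l` — carrying a level-one identity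
design satisfies the crux inequality at `ε`. -/
theorem no_levelOne_witness_of_le {l : ℕ} {ε : ℝ} (hε : 0 < ε)
    (hthr : ((p : ℝ) ^ 2) ^ (2 + ε) ≤ ((p : ℝ) - 2) ^ 2 * (2 : ℝ) ^ ((2 + ε) / 3) * ((p : ℝ) - 1) ^ (2 + ε))
    {H₁ H₂ H₃ : Subgroup (GLm p (1 + l))} (htpp : SubgroupTPP H₁ H₂ H₃)
    (hdes : ∃ c : Mat p (1 + l) → ℂ, (∀ M, 1 < M.rank → c M = 0) ∧
      (∑ M, c M * ZMod.stdAddChar (Matrix.trace (M * ((1 : GLm p (1 + l)) : Mat p (1 + l))))) = 1 ∧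
      ∀ a ∈ H₁, ∀ b ∈ H₂, ∀ g ∈ H₃, a * b * g ≠ 1 →
        (∑ M, c M * ZMod.stdAddChar
          (Matrix.trace (M * ((a * b * g : GLm p (1 + l)) : Mat p (1 + l))))) = 0) :
    ¬ budget p (1 + l) 1 (2 + ε) <
      ((Nat.card H₁ * Nat.card H₂ * Nat.card H₃ : ℕ) : ℝ) ^ ((2 + ε) / 3) :=
  fun hlt => absurd (levelOne_squeeze hε htpp hdes hlt) (not_lt.mpr hthr)

end WitnessWindow
end Summit.MatrixMultiplication.MatrixMultiplication.Theorems.SubgroupIdentityDesigns.Negative
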